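import Literature.NumberTheory.GaloisRepresentations.CrystallineOrdinary
import Literature.NumberTheory.GaloisRepresentations.ModPGaloisRep
import Literature.NumberTheory.GaloisRepresentations.AbsolutelyIrreducibleReduction
import Literature.NumberTheory.PAdicHodge.FontaineDpst
import HarnessLib

/-!
# Ordinary crystalline symplectic lifts of `p`-distinguished ordinary `ρ̄ : Γ_{ℚ_p} → GSp₄(𝔽̄_p)`,
# generic case (Gee–Geraghty 2012, Lemma 7.6.7, over `ℚ_p`)

Topic `Literature/NumberTheory/GaloisRepresentations`.  Cite item of the crux
`stmt-Langlands-17765` (`Summit.Langlands.Langlands.Theses.AbelianSurfaceSerre.SerreGSp4Surjective`),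
line `singer-type-evaporation`, stub `stub_liftExists` (existence of a crystalline-ordinary
symplectic `p`-adic lift of `ρ̄ : Γ_ℚ → GSp₄(𝔽_p)`; the LOCAL input at `p` of the lifting theorem of
Fakhruddin–Khare–Patrikis vendored in the companion file
`FKP2021GeometricLiftGSp4Rational.lean`).  This file has:

* `IsOrdinarySymplecticLocalLiftAt p ρ̄ J v hv e r_v` — the INTERFACE between the local lemma and
  the global lifting theorem (a definition, nothing asserted): `r_v : Γ_{ℚ_v} → GL₄(ℚ̄_p)` is a
  lift of `ρ̄|Γ_{ℚ_v}` (integral, reducing ENTRYWISE to `ρ̄|Γ_{ℚ_v} ⊗ 𝔽̄_p` along a ring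
  homomorphism `red : 𝒪_{ℚ̄_p} → 𝔽̄_p`), symplectic with multiplier EXACTLY `ε_p⁻¹` for an
  integral alternating form `J_v` reducing to `J` along the same `red`, crystalline for Fontaine's
  pinned datum `fontainePstAdicCompletion v p hv`, and (Greenberg-)ordinary with cyclotomic
  exponents `e` (accepted `FramedRep.IsCrystallineOrdinaryOfExponents`);
* ONE NAMED FACT (D-0014), `GeeGeraghty2012_lem767_ordinarySymplecticLift_rat`: Gee–Geraghty's
  Lemma 7.6.7 for `M = ℚ_v` (`v` the place of `ℚ` above `p ≥ 3`), in the vocabulary of the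
  requesting crux (hypothesis (H2) `OrdinaryDistinguishedAt` of the crux, plus GENERICITY).

## The printed statements (held text arXiv:1001.2044 = Duke Math. J. 161 (2012), read 2026-08-17)

T. Gee, D. Geraghty, *Companion forms for unitary and symplectic groups* [GeeGeraghty2012].

* **§7.1** (p. 22 of the held text): "We define `GSp₄` to be the reductive group over `ℤ` defined
  as a subgroup of `GL₄` by `GSp₄(R) = {g ∈ GL₄(R) : g J ᵗg = μ(g) J}` where `μ(g)` is the
  similitude factor (which is uniquely determined by `g`), and `J` is the antisymmetric matrix
  `(0 X; -X 0)` where `X` is the `2 × 2` antidiagonal matrix with all entries on the antidiagonal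
  equal to `1`."  **§7.2** (standing assumptions): "Fix as before a finite field `k` of
  characteristic `l > 2` … Let `M` be a finite extension of `ℚ_p` for some prime `p`, possibly
  equal to `l`. … Let `ρ̄ : G_M → GSp₄(k)` be a continuous representation. … there is a universal
  `𝒪`-lifting `ρ^□ : G_M → GL₄(R^□_ρ̄)`, and it is immediate that there is a quotient
  `R^{□,sympl}_ρ̄` of `R^□_ρ̄` and a universal symplectic lifting `ρ^{□,sympl} : G_M → GSp₄(R^{□,sympl}_ρ̄)`"
  (so a LIFT of `ρ̄` is a `GSp₄(𝒪_E)`-valued continuous homomorphism reducing to `ρ̄` modulo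
  `𝔪_E`).
* **Definition 3.1.2** (p. 6): for `λ ∈ (ℤⁿ_+)^{Hom(M,K)}`, "`χ^λ_j : I_M → 𝒪^×`,
  `σ ↦ ε(σ)^{-(j-1)} ∏_{τ} τ(Art_M⁻¹(σ))^{-λ_{τ,n-j+1}}`.  Note that `χ^λ_j` can also be thought of
  as the restriction to `I_M` of any crystalline character `G_M → ℚ̄_l^×` whose Hodge–Tate weight
  with respect to `τ` is given by `(j-1) + λ_{τ,n-j+1}` for all `τ` (we use the convention that
  the Hodge–Tate weights of `ε` are all `-1`)."  **Definition 3.1.3** (p. 7): `ρ : G_M → GL_n(B)`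
  is "ordinary of weight `λ`" if it "is conjugate to a representation of the form
  (upper triangular with diagonal `ψ₁, …, ψ_n`) where for each `j` the character `ψ_j` agrees on an
  open subgroup of `I_M` with the character `χ^λ_j`".
* **Lemma 7.6.7** (p. 31), verbatim: "Let `M` be a finite extension of `ℚ_l`. Take
  `λ ∈ (ℤ⁴_+)^{Hom(M,ℚ̄_l)}`. Let `E` be a finite extension of `ℚ_l` with residue field `k`. Let
  `ψ_i`, `1 ≤ i ≤ 4`, be crystalline characters `G_M → E^×`, with `ψ_i|_{I_M} = χ_i^λ|_{I_M}` in the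
  notation of Definition 3.1.2. Assume that `ψ₁ψ₄ = ψ₂ψ₃`. Suppose that `ρ̄ : G_M → GSp₄(k)` is of
  the form `(μ̄₁ * * *; 0 μ̄₂ * *; 0 0 μ̄₃ *; 0 0 0 μ̄₄)` where `ψ̄_i = μ̄_i` for `1 ≤ i ≤ 4`. Suppose
  that none of the characters `μ̄_i μ̄_j⁻¹`, `i < j`, are equal to `ε̄`. Then `ρ̄` has a lift to a
  crystalline representation `ρ : G_M → GSp₄(E)` of the form
  `(ψ₁ * * *; 0 ψ₂ * *; 0 0 ψ₃ *; 0 0 0 ψ₄)`."  ("Proof. This is proved in exactly the same way as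
  Lemma 3.1.5." — Lemma 3.1.5, p. 7: "any upper-triangular representation of this form is
  crystalline … because the assumption that `μ̄_iμ̄_j⁻¹ ≠ ε` implies that `ψ_iψ_j⁻¹ ≠ ε`.  The fact that
  such an upper-triangular lift exists follows from the fact that `H²(G_M, 𝔲) = 0`, where `𝔲` is the
  subspace of the Lie algebra `ad ρ̄` consisting of strictly upper-triangular matrices … Tate local
  duality … graded pieces one-dimensional with `G_M` acting via the characters `μ̄_iμ̄_j⁻¹ ≠ ε`,
  `i < j`.")

## The rendering (read before reviewing), and why it follows from print

Statement rendered: `p ≥ 3` prime; `ρ̄ : Γ_ℚ → GL₄(𝔽_p)` continuous (`FramedGaloisRep ℚ (ZMod p) 4`)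
preserving an alternating non-degenerate `J ∈ M₄(𝔽_p)` up to the multiplier `ε̄_p⁻¹`
(`Jᵀ = -J`, `det J` a unit, `ρ̄(g)ᵀ J ρ̄(g) = ε̄_p(g)⁻¹ J` — VERBATIM the first three clauses of the
crux's hypothesis (H1) `FullSymplecticImage`); `v` the place of `ℚ` above `p`; and a frame
`g ∈ GL₄(𝔽̄_p)` in which `ρ̄|Γ_{ℚ_v} ⊗ 𝔽̄_p` is UPPER TRIANGULAR with PAIRWISE DISTINCT diagonal
characters `d_i` (VERBATIM the clause of the crux's hypothesis (H2) `OrdinaryDistinguishedAt` at `v`)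
which are moreover GENERIC: `d_i ≠ ε̄_p · d_j` for ALL `i ≠ j` (Gee–Geraghty ask it for `i < j` in
the symplectic flag only: the hypothesis here is stronger, the fact weaker).  CONCLUSION: there are
strictly decreasing integers `e₀ > e₁ > e₂ > e₃` and `r_v : Γ_{ℚ_v} → GL₄(ℚ̄_p)` with
`IsOrdinarySymplecticLocalLiftAt p ρ̄ J v hv e r_v`.

Derivation from Lemma 7.6.7 (routine steps, each standard):
1. (An isotropic invariant flag.)  Put `V = 𝔽̄_p⁴` with `Γ = Γ_{ℚ_v}` acting through
   `ρ̄_v := ρ̄|Γ_{ℚ_v}` and the alternating form `⟨x, y⟩ = xᵀ J y`, so `⟨γx, γy⟩ = ε̄⁻¹(γ)⟨x, y⟩`.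
   The frame `g` gives a `Γ`-stable full flag, hence the image `H = ρ̄_v(Γ)` lies in a Borel
   subgroup of `GL₄(𝔽̄_p)` and EVERY `H`-subquotient of `V` again has an `H`-stable full flag.
   Take `L₁` the `H`-stable line of the given flag (isotropic, the form being alternating;
   `L₁^⊥ ⊇ L₁` is `H`-stable because `H` preserves the form up to scalars), `L₂ ⊃ L₁` the preimage
   of an `H`-stable line of `L₁^⊥/L₁` (a Lagrangian plane: `L₂^⊥ = L₂`), and `L₃ = L₁^⊥ ⊇ L₂`.
   This is an `H`-stable SELF-DUAL full flag; its graded characters `(μ̄₁, μ̄₂, μ̄₃, μ̄₄)` are a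
   permutation of the `d_i` (Jordan–Hölder), so pairwise distinct and generic in Gee–Geraghty's
   sense, and `μ̄₁μ̄₄ = μ̄₂μ̄₃ = ε̄⁻¹` (`V/L₃ ≅ L₁^∨ ⊗ ε̄⁻¹`, `L₃/L₂ ≅ (L₂/L₁)^∨ ⊗ ε̄⁻¹`).  All of this
   is defined over a finite `k' ⊂ 𝔽̄_p`.  A symplectic basis adapted to the isotropic flag
   (Darboux) is a matrix `h ∈ GL₄(k')` with `J = hᵀ J₀ h` (`J₀` Gee–Geraghty's matrix) and
   `ρ̄' := h ρ̄_v h⁻¹ : Γ → GSp₄(k')` upper triangular with diagonal `(μ̄₁, …, μ̄₄)` — the shape of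
   Lemma 7.6.7.  (Gee–Geraghty write `g J ᵗg = μ J`; for `J₀⁻¹ = -J₀` this is the same group as
   `{ᵗg J g = μ J}`.)
2. (The weight and the characters `ψ_i`.)  Every continuous character `Γ_{ℚ_p} → k'^×` is
   `ū · ε̄^c` with `ū` unramified and `c ∈ ℤ/(p-1)` (its restriction to inertia factors through the
   tame quotient and is Frobenius-invariant; Serre 1972, §1.7, Prop. 3).  Write `μ̄_i = ū_i ε̄^{c_i}`;
   then `ū₁ū₄ = ū₂ū₃ = 1` and `c₁ + c₄ ≡ c₂ + c₃ ≡ -1`.  Choose integers `e₁ > e₂ > e₃ > e₄`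
   (indexed `e 0 > e 1 > e 2 > e 3` in the statement) with `e_i ≡ c_i (mod p-1)` and
   `e₁ + e₄ = e₂ + e₃ = -1` (take `e₂ ≥ 1` in the class of `c₂`, `e₃ = -1 - e₂`, then `e₁ > e₂` in the
   class of `c₁`, `e₄ = -1 - e₁`), let `u_i : Γ_{ℚ_p} → W(k')^×` be the unramified character whose
   value at Frobenius is the Teichmüller lift of `ū_i(Frob)` (so `u₁u₄ = u₂u₃ = 1`) and
   `ψ_i := u_i ε^{e_i}`: crystalline characters `G_{ℚ_p} → E^×`, `E = W(k')[1/p]`, with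
   `ψ̄_i = μ̄_i`, `ψ₁ψ₄ = ψ₂ψ₃ = ε⁻¹`, and `ψ_i|_{I} = χ_i^λ` for the dominant weight
   `λ = (-e₄ - 3, -e₃ - 2, -e₂ - 1, -e₁)` (Hodge–Tate weight of `ψ_i` is `-e_i = (i-1) + λ_{5-i}`,
   convention `HT(ε) = -1` on both sides; `λ_j ≥ λ_{j+1}` because `e_i - e_{i+1} ≥ 1`).
3. (Lemma 7.6.7.)  For `p ≥ 3` (`l > 2`, §7.2) it gives `ρ' : Γ_{ℚ_v} → GSp₄(𝒪_E) ⊂ GSp₄(E)`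
   reducing to `ρ̄'`, crystalline, upper triangular with diagonal `(ψ₁, ψ₂, ψ₃, ψ₄)`, multiplier
   `ψ₁ψ₄ = ε⁻¹`.
4. (Undo the frame.)  Lift `h` to `h̃ ∈ GL₄(𝒪_E)` and put `r_v := h̃⁻¹ ρ' h̃`,
   `J_v := h̃ᵀ J₀ h̃`.  Then `r_v` has entries in `𝒪_E ⊂ 𝒪_{ℚ̄_p}` and reduces entrywise to
   `h⁻¹ ρ̄' h = ρ̄_v ⊗ k'`; `J_v` is alternating and reduces to `hᵀ J₀ h = J`;
   `r_vᵀ J_v r_v = h̃ᵀ ρ'ᵀ J₀ ρ' h̃ = ε⁻¹ J_v`; `r_v` is crystalline (a conjugate of `ρ'`) and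
   ordinary with cyclotomic exponents `e` and unramified `u_i` in the frame `h̃`
   (`FramedRep.IsCrystallineOrdinaryOfExponents p r_v e`).  The reduction map is any ring
   homomorphism `red : 𝒪_{ℚ̄_p} → 𝒪_{ℚ̄_p}/𝔪 ≅ 𝔽̄_p` extending `𝒪_E → k' ⊂ 𝔽̄_p` (two
   identifications of `𝒪_{ℚ̄_p}/𝔪` with `AlgebraicClosure (ZMod p)` differ by an automorphism of
   `𝔽̄_p`, which we may compose away).  "Crystalline" is rendered, as in every statement of the
   summit, by `IsCrystallineFramed` for the pinned Fontaine datum `fontainePstAdicCompletion v p hv`.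
* WEAKER than print / NOT here:
  -- TODO(general form): any finite `M/ℚ_l` and any dominant `λ ∈ (ℤ⁴_+)^{Hom(M, ℚ̄_l)}` with
  -- PRESCRIBED crystalline `ψ_i` (here: `M = ℚ_p`, some `λ` chosen as in step 2, multiplier
  -- pinned to `ε⁻¹`); residual coefficients a general finite `k` (here `k = 𝔽_p`, read in `𝔽̄_p`);
  -- genericity only for `i < j` in the isotropic flag (here for all `i ≠ j`); the `GL_n` version
  -- Lemma 3.1.5.  The NON-generic case (some `μ̄_iμ̄_j⁻¹ = ε̄`) is NOT covered by the lemma (its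
  -- `H²` does not vanish); see the separate file `OrdinaryCrystallineSymplecticLiftNonGeneric`.

## References

* [GeeGeraghty2012] T. Gee, D. Geraghty, Duke Math. J. 161 (2012) 247–303: Lemma 7.6.7, Lemma 3.1.5,
  Def. 3.1.2–3.1.3, §7.1–7.2 (arXiv:1001.2044 pp. 31, 7, 6, 22).
* [Serre1972] J.-P. Serre, Invent. Math. 15 (1972), §1.7, Prop. 3 (characters of `G_{ℚ_p}` with
  values in `𝔽̄_p^×`: unramified twists of powers of the cyclotomic character).
* [BarnetlambEtAl2014] §1.4 (crystalline = `B_cris`-admissible; ordinary), Introduction (`HT(ε) = -1`).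
-/

noncomputable section

open scoped MatrixGroups Matrix NumberField
open NumberField IsDedekindDomain Field Filter

namespace Literature.NumberTheory.GaloisRepresentations

/-- **A crystalline ordinary symplectic local lift of `ρ̄|Γ_{ℚ_v}` with cyclotomic exponents `e`**
(the interface between the local lifting lemma `GeeGeraghty2012_lem767_ordinarySymplecticLift_rat`
and the global lifting theorem `FKP2021_thmA_ordinaryCrystallineLift_GSp4_rat`; a DEFINITION,
nothing is asserted).  For `ρ̄ : Γ_ℚ → GL₄(𝔽_p)`, an alternating `J ∈ M₄(𝔽_p)`, the place `v ∣ p`,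
exponents `e : Fin 4 → ℤ` and `r_v : Γ_{ℚ_v} → GL₄(ℚ̄_p)` continuous: there are an INTEGRAL matrix
`J_v ∈ M₄(𝒪_{ℚ̄_p})` (`𝒪_{ℚ̄_p} = {‖x‖ ≤ 1}`, Mathlib `Valued.v.valuationSubring`) and a ring
homomorphism `red : 𝒪_{ℚ̄_p} → 𝔽̄_p` (any such is the reduction modulo `𝔪` followed by an
identification `𝒪_{ℚ̄_p}/𝔪 ≅ 𝔽̄_p`) such that: (i) `r_v` is integral and REDUCES ENTRYWISE to
`ρ̄|Γ_{ℚ_v} ⊗ 𝔽̄_p` along `red` (a genuine lift, not only up to semisimplification); (ii) `J_v`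
reduces to `J`, is alternating, and `r_v(τ)ᵀ J_v r_v(τ) = ε_p(τ)⁻¹ J_v` — `r_v` is `GSp(J_v)`-valued
with multiplier EXACTLY the inverse cyclotomic character of `Γ_{ℚ_v}` ("a lift of type `μ = ε⁻¹`" in
Fakhruddin–Khare–Patrikis' sense, "similitude factor `ε⁻¹`" in Gee–Geraghty's); (iii) `r_v` is
crystalline for Fontaine's pinned datum at `v`; (iv) `r_v` is ordinary with cyclotomic exponents
`e`: upper triangular in some frame with diagonal `u_i · ε^{e_i}`, `u_i` unramified
(`FramedRep.IsCrystallineOrdinaryOfExponents`; Gee–Geraghty's "ordinary of weight `λ`",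
`-e_i = (i-1) + λ_{5-i}`, with crystalline `ψ_i = u_i ε^{e_i}`).
[cite: GeeGeraghty2012, §7.2 (symplectic liftings) and Def. 3.1.3] -/
def IsOrdinarySymplecticLocalLiftAt (p : ℕ) [Fact p.Prime] (ρ : FramedGaloisRep ℚ (ZMod p) 4)
    (J : Matrix (Fin 4) (Fin 4) (ZMod p)) (v : HeightOneSpectrum (𝓞 ℚ))
    (hv : ((p : ℕ) : 𝓞 ℚ) ∈ v.asIdeal) (e : Fin 4 → ℤ)
    (rv : FramedRep (absoluteGaloisGroup (v.adicCompletion ℚ)) (PadicAlgCl p) 4) : Prop :=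
  ∃ (Jv : Matrix (Fin 4) (Fin 4) (Valued.v : Valuation (PadicAlgCl p) NNReal).valuationSubring)
    (red : (Valued.v : Valuation (PadicAlgCl p) NNReal).valuationSubring →+*
      AlgebraicClosure (ZMod p)),
    -- (i) `r_v` is integral and reduces ENTRYWISE to `ρ̄|Γ_{ℚ_v} ⊗ 𝔽̄_p` along `red`
    (∀ τ : absoluteGaloisGroup (v.adicCompletion ℚ),
      ∃ M : Matrix (Fin 4) (Fin 4) (Valued.v : Valuation (PadicAlgCl p) NNReal).valuationSubring,
        M.map (Valued.v : Valuation (PadicAlgCl p) NNReal).valuationSubring.subtype = (rv τ).val ∧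
          M.map red =
            ((ρ.toLocal v τ).val).map (algebraMap (ZMod p) (AlgebraicClosure (ZMod p)))) ∧
    -- (ii) `J_v` is an integral alternating form reducing to `J`, and `r_v` preserves it up to
    -- the multiplier `ε_p(τ)⁻¹` (the cyclotomic character of `Γ_{ℚ_v}`)
    Jv.map red = J.map (algebraMap (ZMod p) (AlgebraicClosure (ZMod p))) ∧ Jvᵀ = -Jv ∧
    (∀ τ : absoluteGaloisGroup (v.adicCompletion ℚ),
      (rv τ).valᵀ * Jv.map (Valued.v : Valuation (PadicAlgCl p) NNReal).valuationSubring.subtype *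
          (rv τ).val =
        (algebraMap ℚ_[p] (PadicAlgCl p)
          ((((GaloisRep.cyclotomicCharacter (v.adicCompletion ℚ) p τ)⁻¹ : ℤ_[p]ˣ) : ℤ_[p]) :
            ℚ_[p])) •
          Jv.map (Valued.v : Valuation (PadicAlgCl p) NNReal).valuationSubring.subtype) ∧
    -- (iii) crystalline for Fontaine's pinned datum, (iv) ordinary with cyclotomic exponents `e`
    (PAdicHodge.fontainePstAdicCompletion v p hv).IsCrystallineFramed rv ∧
    FramedRep.IsCrystallineOrdinaryOfExponents p rv e

/-- **Gee–Geraghty 2012, Lemma 7.6.7, over `ℚ_p`: a GENERIC `p`-distinguished ordinary symplectic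
`ρ̄|Γ_{ℚ_p}` has a crystalline ordinary symplectic lift** (see the module docstring for the printed
lemma and for the derivation of this rendering, steps 1–4).  Let `p ≥ 3` be prime and
`ρ̄ : Γ_ℚ → GL₄(𝔽_p)` continuous, preserving an alternating non-degenerate `J` up to the multiplier
`ε̄_p⁻¹` (`Jᵀ = -J`, `det J ∈ 𝔽_pˣ`, `ρ̄(g)ᵀ J ρ̄(g) = ε̄_p(g)⁻¹ J`: the crux's (H1) without its image
clause).  Let `v` be the place of `ℚ` above `p` and suppose that in some frame `g ∈ GL₄(𝔽̄_p)` the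
restriction `ρ̄|Γ_{ℚ_v} ⊗ 𝔽̄_p` is UPPER TRIANGULAR with diagonal characters `d₀, …, d₃` that are
PAIRWISE DISTINCT (the crux's (H2) at `v`) and GENERIC: `d_i ≠ ε̄_p · d_j` for all `i ≠ j`.  THEN
there are strictly decreasing integers `e` and `r_v : Γ_{ℚ_v} → GL₄(ℚ̄_p)` which is a crystalline
ordinary symplectic lift of `ρ̄|Γ_{ℚ_v}` with exponents `e` and multiplier `ε_p⁻¹`
(`IsOrdinarySymplecticLocalLiftAt`).  Printed: "Suppose that `ρ̄ : G_M → GSp₄(k)` is of the form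
(upper triangular, diagonal `μ̄₁, …, μ̄₄`) where `ψ̄_i = μ̄_i` … Suppose that none of the characters
`μ̄_iμ̄_j⁻¹`, `i < j`, are equal to `ε̄`. Then `ρ̄` has a lift to a crystalline representation
`ρ : G_M → GSp₄(E)` of the form (upper triangular, diagonal `ψ₁, …, ψ₄`)", applied with `M = ℚ_p`,
the isotropic flag extracted from the frame `g` and a symplectic basis for `J` (Darboux), and
`ψ_i = u_i ε^{e_i}` the crystalline lifts of step 2 of the module docstring (`ψ₁ψ₄ = ψ₂ψ₃ = ε⁻¹`).
Named fact (D-0014); users take `(h : GeeGeraghty2012_lem767_ordinarySymplecticLift_rat)`.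
-- TODO(general form): finite `M/ℚ_l`, prescribed `λ` and `ψ_i`, general finite `k`, genericity
-- for `i < j` only; the non-generic case is NOT asserted here.
[cite: GeeGeraghty2012, Lemma 7.6.7 (with Lemma 3.1.5, Def. 3.1.2–3.1.3, §7.1–7.2)]
[cite: Serre1972, §1.7 Prop. 3] -/
def GeeGeraghty2012_lem767_ordinarySymplecticLift_rat : Prop :=
  ∀ (p : ℕ) [Fact p.Prime], 3 ≤ p →
    ∀ (ρ : FramedGaloisRep ℚ (ZMod p) 4) (J : Matrix (Fin 4) (Fin 4) (ZMod p)),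
      -- `ρ̄ : Γ_ℚ → GSp(J)(𝔽_p)` with multiplier `ε̄_p⁻¹`
      Jᵀ = -J → IsUnit J.det →
      (∀ g : absoluteGaloisGroup ℚ, (ρ g).valᵀ * J * (ρ g).val =
        (((modPCyclotomicCharacterZMod ℚ p g)⁻¹ : (ZMod p)ˣ) : ZMod p) • J) →
    ∀ (v : HeightOneSpectrum (𝓞 ℚ)) (hv : ((p : ℕ) : 𝓞 ℚ) ∈ v.asIdeal),
      -- at `v ∣ p`: upper triangular in the frame `g` over `𝔽̄_p`, with pairwise distinct and
      -- GENERIC diagonal characters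
      (∃ g : GL (Fin 4) (AlgebraicClosure (ZMod p)),
        (∀ (τ : absoluteGaloisGroup (v.adicCompletion ℚ)) (i j : Fin 4), j < i →
          (g.val * ((ρ.toLocal v τ).val.map (algebraMap (ZMod p) (AlgebraicClosure (ZMod p)))) *
            (g⁻¹).val) i j = 0) ∧
        (∀ i j : Fin 4, i ≠ j → ∃ τ : absoluteGaloisGroup (v.adicCompletion ℚ),
          (g.val * ((ρ.toLocal v τ).val.map (algebraMap (ZMod p) (AlgebraicClosure (ZMod p)))) *
              (g⁻¹).val) i i ≠
            (g.val * ((ρ.toLocal v τ).val.map (algebraMap (ZMod p) (AlgebraicClosure (ZMod p)))) *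
              (g⁻¹).val) j j) ∧
        (∀ i j : Fin 4, i ≠ j → ∃ τ : absoluteGaloisGroup (v.adicCompletion ℚ),
          (g.val * ((ρ.toLocal v τ).val.map (algebraMap (ZMod p) (AlgebraicClosure (ZMod p)))) *
              (g⁻¹).val) i i ≠
            algebraMap (ZMod p) (AlgebraicClosure (ZMod p))
                ((modPCyclotomicCharacterZMod ℚ p (absGaloisRestrict ℚ (v.adicCompletion ℚ) τ) :
                  (ZMod p)ˣ) : ZMod p) *
              (g.val * ((ρ.toLocal v τ).val.map (algebraMap (ZMod p) (AlgebraicClosure (ZMod p)))) *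
                (g⁻¹).val) j j)) →
      -- CONCLUSION: a crystalline ordinary symplectic lift with strictly decreasing exponents
      ∃ (e : Fin 4 → ℤ) (rv : FramedRep (absoluteGaloisGroup (v.adicCompletion ℚ)) (PadicAlgCl p) 4),
        StrictAnti e ∧ IsOrdinarySymplecticLocalLiftAt p ρ J v hv e rv

end Literature.NumberTheory.GaloisRepresentations

end
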